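import Summits.BirchSwinnertonDyer.BirchSwinnertonDyer.Theorems.GoldfeldAllTwistsTwoConverseTwinBirchFixedCurve
import Summits.BirchSwinnertonDyer.BirchSwinnertonDyer.Theorems.GoldfeldAllTwistsTwoConverseTwinGenusPeriodsTwist
import Literature.NumberTheory.EllipticCurves.HeegnerPointReflectionProofs
import Literature.NumberTheory.EllipticCurves.ModularCurveRealPeriodProofs
import Literature.NumberTheory.EllipticCurves.ModularSymbolsHeckeProofs
import Literature.NumberTheory.EllipticCurves.AnalyticRankModularityProofs
import Literature.NumberTheory.EllipticCurves.ComplexMultiplicationBurungaleFlachProofs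
import Literature.NumberTheory.EllipticCurves.X049CuspZeroTwoTorsion
import HarnessLib

set_option linter.dupNamespace false -- namespace `…BirchSwinnertonDyer.BirchSwinnertonDyer…` is the cell's (D-0017 nested layout)
set_option autoImplicit false

/-!
# (T-φ0) «the cusp `0` of `X₀(49)` maps to the `2`-torsion point `T = (2, −1)` of `49a1`», PROVED modulo the
# cone binder `h12` (Coates–Li–Tian–Zhai Thm. 1.2 at `R = 1`)

Cell `bsd-goldfeld`, seat `bsd-goldfeld-s1p-c3` (prover, gen 16); planner g32 rulings (cxliv)/(cxlvi), ORDER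
«CUSP-ZERO-TWO-TORSION» (one proposer = c3; the NAME `x049_cuspZeroPoint_eq_twoTorsion` is seat ty's Literature def,
p533890 — not restated here, only PROVED modulo `h12` in §5). Support for item `stmt-BirchSwinnertonDyer-20044` (K12₂″)
and the c3x lane on `stmt-BirchSwinnertonDyer-19350`: the residual binder (d) of seat c201's FILE 2 and the sub-input
«φ₀(0) = T» of seat c3x's assembly (hY/hΨ), in the VERBATIM consumer shape of planner g31 (cxli) ADDENDUM (5):

  `∀ Dt : ModularForms.ModularParametrizationData cm7 49, Odd Dt.c → ∃ h, Dt.cuspZeroPoint = .some 2 (-1) h`,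

derived from `CoatesLiTianZhai2015.thm12_fullBSD_twist` (the cell's standing binder `h12`) and the tree; consumers
discharge `h0 := x049_cuspZeroPoint_eq_twoTorsion_holds_of_thm12 h12`. HONEST FRAMING:
the transcendental input `L(49a1, 1)/Ω(49a1) = #Ш(49a1)/2` with `#Ш` odd enters BY NAME through `h12` (CLTZ Thm. 1.2,
case `r = 0`: full BSD for `A = X₀(49)`); nothing here proves BSD; no item is closed; density-zero families.

## The argument

`φ(0) = uniformize (c · {∞,0}_f)` (`ModularParametrizationData.cuspZeroPoint`). (§2) `{∞,0}_f = L(f,1) = L(cm7,1)`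
(`modularSymbol_zero_eq`, `IsNewformOf`: the datum's `f` is the newform of `cm7`). (§1) Granted `h12`:
`BSDTriple cm7` with `rank = 0`, `#cm7(ℚ) = 2`, `Tam = 2`, so `L(cm7,1) = #Ш · Ω · 2/2² = (#Ш/2)·Ω`, `#Ш` odd.
(§3) `Ω = Ω(cm7) = Ω₀(Λ_E)` is the least positive real period of the Néron lattice `Λ_E = Dt.L.lattice` (`Δ < 0`: one
real component; `realPeriodRat_eq_numRealComponents_mul`), a REAL lattice (`isReal_neronLattice`): `Ω ∈ Λ_E`,
`Ω/2 ∉ Λ_E`; hence for `c` odd, `c · #Ш · Ω/2 ≡ Ω/2 (mod Λ_E)` and `φ(0) = uniformize(Ω/2) =: P` with `P ≠ O`,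
`P + P = O` and `P̄ = P` (`uniformize_conj`). (§4) On `cm7 : y² + xy = x³ − x² − 2x − 1` a point `P = (x, y)` with
`P = −P` has `2y + x = 0`, so `4x³ − 3x² − 8x − 4 = (x − 2)(4x² + 5x + 2) = 0`; with `x` real (`P̄ = P`) the quadratic
factor (`disc = −7`) does not vanish, so `x = 2`, `y = −1`. For EVEN `c` (including the degenerate `c = 0` the
structure allows) the same computation gives `φ(0) = O`, so `Odd Dt.c` is the right hypothesis.

References: [CremonaAlgorithms1997] J. E. Cremona, *Algorithms for modular elliptic curves* (1997), §2.8 (2.8.3),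
§2.10, Table 1 (curve 49A1); [CoatesLiTianZhai2015] Thm. 1.2; [Manin1972] Thm. 1.3; [SilvermanAEC2009] III.2.3,
VI.5.1, C.16.
-/

noncomputable section

open scoped Classical ComplexConjugate

namespace Summit.BirchSwinnertonDyer.BirchSwinnertonDyer.Theorems.GoldfeldGoodTwists

open WeierstrassCurve Complex Literature.NumberTheory Literature.NumberTheory.EllipticCurves
  Literature.NumberTheory.EllipticCurves.ModularForms
  Summit.BirchSwinnertonDyer.Rank1Residual.P2

/-! ## §1 `L(X₀(49), 1) = (#Ш/2) · Ω(X₀(49))`, `#Ш` odd — granted CLTZ Thm. 1.2 at `R = 1` -/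

/-- **`L(cm7, 1) = (S/2) · Ω(cm7)` with `S = #Ш(cm7)` ODD**, granted `h12` (CLTZ Thm. 1.2, `r = 0`: `BSDTriple cm7`,
rank `0`, `#Ш` odd) and the tree's `#cm7(ℚ) = 2` (`natCard_point_cm7`), `Tam(cm7) = c₇ = 2` (`tamagawaProduct_cm7`).
[cite: CoatesLiTianZhai2015, Thm. 1.2 (p. 359, case r = 0)] [cite: CremonaAlgorithms1997, Table 1 (49A1)] -/
theorem cm7_entireLFunction_one_eq_of_thm12 (h12 : CoatesLiTianZhai2015.thm12_fullBSD_twist) :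
    ∃ S : ℕ, Odd S ∧ cm7.entireLFunction 1 = (((S : ℝ) / 2 * cm7.realPeriodRat : ℝ) : ℂ) := by
  have hC : ∃ C : VariableChange ℚ, C • cm7 = cm7.quadraticTwist ((1 : ℕ) : ℚ) := by
    rw [Nat.cast_one]
    exact cm7.exists_variableChange_quadraticTwist_one
  obtain ⟨-, hmw, -, hodd, hrank, -, hlead⟩ := CoatesLiTianZhai2015.bsdTriple_cm7_of_thm12 h12 hC
  have hr0 : cm7.analyticRank = 0 := by
    have h : cm7.analyticRank = cm7.mordellWeilRank := hrank
    rw [h, hmw]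
  haveI : Finite cm7.toAffine.Point := Nat.finite_of_card_ne_zero (by rw [natCard_point_cm7]; norm_num)
  have h1 : cm7.entireLFunction 1 = (cm7.bsdRHS : ℂ) := by
    rw [← cm7.leadingLCoeff_eq_of_analyticRank_eq_zero hr0]
    exact hlead
  refine ⟨cm7.shaOrder, hodd, ?_⟩
  rw [h1, cm7.bsdRHS_eq_of_finite, tamagawaProduct_cm7, natCard_point_cm7]
  push_cast
  ring

/-! ## §2 `{∞, 0}_f = L(W, 1)` for every modular parametrisation datum -/

/-- **`{∞,0}_f = L(W,1)`** for the newform `f = Dt.f` of ANY datum `Dt` of an elliptic `W/ℚ`: `{∞,0}_f = L(f,1)`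
(Manin / Cremona (2.8.3), tree `modularSymbol_zero_eq_holds`) and `L(f,s) = L(W,s)` (`IsNewformOf`), read on the entire
continuation `W.entireLFunction`. [cite: CremonaAlgorithms1997, §2.8 (2.8.3)] [cite: Manin1972, Thm. 1.3] -/
theorem modularSymbol_zero_eq_entireLFunction_one {W : WeierstrassCurve ℚ} {N : ℕ} [NeZero N]
    (Dt : ModularParametrizationData W N) : modularSymbol Dt.f 0 = W.entireLFunction 1 := by
  have hE : W.HasEntireLFunction :=
    WeierstrassCurve.hasEntireLFunction_of_cuspCoeff_eq (CongruenceSubgroup.strictWidthInfty_Gamma0 _) W Dt.f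
      Dt.isNewformOf.2
  refine modularSymbol_zero_eq_holds Dt.f (W.differentiable_entireLFunction hE) fun s hs ↦ ?_
  rw [W.entireLFunction_eq_LSeries hE (by linarith), Dt.isNewformOf.cuspFormLSeries_eq]

/-! ## §3 The Néron lattice of `X₀(49)`: `Ω(cm7) = Ω₀(Λ_E)`, and `uniformize` of an odd multiple of `Ω/2` -/

section Lattice

variable (Dt : ModularParametrizationData cm7 49)

/-- **`Ω(cm7) = Ω₀(Λ_E)`**: the real period of `X₀(49)` (one real component, `Δ = −7³ < 0`) is the least positive real
period of the Néron lattice `Λ_E = Dt.L.lattice` of any datum. [cite: CremonaAlgorithms1997, §2.8 (p. 26) and §3.7] -/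
theorem realPeriodRat_cm7_eq_minRealPeriod : cm7.realPeriodRat = Dt.L.minRealPeriod := by
  rw [Dt.realPeriodRat_eq_numRealComponents_mul, numRealComponents_cm7, Nat.cast_one, one_mul]

/-- For an ODD integer `m`: `uniformize (m · Ω/2) = uniformize (Ω/2)` on the Néron lattice of `X₀(49)` (`Ω ∈ Λ_E`).
[cite: SilvermanAEC2009, VI.5.1] -/
theorem uniformize_odd_mul_half_realPeriod {m : ℤ} (hm : Odd m) :
    Dt.uniformize ((m : ℂ) * ((cm7.realPeriodRat / 2 : ℝ) : ℂ)) = Dt.uniformize ((cm7.realPeriodRat / 2 : ℝ) : ℂ) := by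
  obtain ⟨k, rfl⟩ := hm
  have hΩ : ((cm7.realPeriodRat : ℝ) : ℂ) ∈ Dt.L.lattice := by
    rw [realPeriodRat_cm7_eq_minRealPeriod Dt]
    exact Dt.isReal_neronLattice.minRealPeriod_mem_lattice
  rw [← sub_eq_zero, ← map_sub, Dt.uniformize_eq_zero_iff]
  have e : (((2 * k + 1 : ℤ)) : ℂ) * ((cm7.realPeriodRat / 2 : ℝ) : ℂ) - ((cm7.realPeriodRat / 2 : ℝ) : ℂ) =
      k • ((cm7.realPeriodRat : ℝ) : ℂ) := by
    rw [zsmul_eq_mul]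
    push_cast
    ring
  rw [e]
  exact zsmul_mem hΩ k

/-- **`P := uniformize (Ω/2)` is a nonzero point with `P + P = O` fixed by complex conjugation** (`Ω/2 ∉ Λ_E ∋ Ω`,
`Λ_E` real, `uniformize_conj`). [cite: SilvermanAEC2009, VI.5.1 and V.2] -/
theorem uniformize_half_realPeriod_spec :
    Dt.uniformize ((cm7.realPeriodRat / 2 : ℝ) : ℂ) ≠ 0 ∧
      Dt.uniformize ((cm7.realPeriodRat / 2 : ℝ) : ℂ) + Dt.uniformize ((cm7.realPeriodRat / 2 : ℝ) : ℂ) = 0 ∧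
      conjPoint cm7 (Dt.uniformize ((cm7.realPeriodRat / 2 : ℝ) : ℂ)) =
        Dt.uniformize ((cm7.realPeriodRat / 2 : ℝ) : ℂ) := by
  have hreal := Dt.isReal_neronLattice
  refine ⟨?_, ?_, ?_⟩
  · rw [Ne, Dt.uniformize_eq_zero_iff, realPeriodRat_cm7_eq_minRealPeriod Dt]
    exact hreal.half_minRealPeriod_notMem
  · rw [← map_add, Dt.uniformize_eq_zero_iff, realPeriodRat_cm7_eq_minRealPeriod Dt,
      show ((Dt.L.minRealPeriod / 2 : ℝ) : ℂ) + ((Dt.L.minRealPeriod / 2 : ℝ) : ℂ) = ((Dt.L.minRealPeriod : ℝ) : ℂ) by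
        push_cast; ring]
    exact hreal.minRealPeriod_mem_lattice
  · rw [← uniformize_conj Dt, Complex.conj_ofReal]

end Lattice

/-! ## §4 On `X₀(49)`: a real point `P` with `P = −P`, `P ≠ O` is `T = (2, −1)` -/

/-- **The only nonzero `2`-torsion point of `X₀(49)` with real coordinates is `T = (2, −1)`.** On
`cm7 : y² + xy = x³ − x² − 2x − 1`, `P = (x, y) = −P` means `y = −y − x`; then `4x³ − 3x² − 8x − 4 =
(x − 2)(4x² + 5x + 2) = 0`, and for real `x` the quadratic factor (discriminant `−7`) is positive, so `x = 2`, `y = −1`.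
[cite: SilvermanAEC2009, III.2.3 (negation formula)] [cite: CremonaAlgorithms1997, Table 1 (49A1: #E(ℚ)_tors = 2)] -/
theorem cm7_eq_two_neg_one_of_add_self_eq_zero_of_conj {P : (cm7.baseChange ℂ).toAffine.Point} (hP0 : P ≠ 0)
    (h2 : P + P = 0) (hconj : conjPoint cm7 P = P) :
    ∃ h, P = WeierstrassCurve.Affine.Point.some (x := 2) (y := -1) h := by
  rcases P with _ | @⟨x, y, hxy⟩
  · exact absurd rfl hP0
  · -- `P = -P`: `y = negY x y = -y - x`
    have hneg : y = -y - x := by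
      have h := eq_neg_of_add_eq_zero_left h2
      rw [Affine.Point.neg_some, Affine.Point.some.injEq] at h
      have h' := h.2
      simp [Affine.negY, baseChange] at h'
      linear_combination h'
    -- real coordinates
    have hx : conj x = x ∧ conj y = y := by
      have h := hconj
      rw [conjPoint, Affine.Point.map_some, Affine.Point.some.injEq] at h
      simpa using h
    obtain ⟨r, hr⟩ : ∃ r : ℝ, (r : ℂ) = x := ⟨x.re, conj_eq_iff_re.mp hx.1 ▸ rfl⟩
    obtain ⟨s, hs⟩ : ∃ s : ℝ, (s : ℂ) = y := ⟨y.re, conj_eq_iff_re.mp hx.2 ▸ rfl⟩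
    -- the equation of `cm7`
    have heq : y ^ 2 + x * y = x ^ 3 - x ^ 2 - 2 * x - 1 := by
      have h := (Affine.equation_iff _ _).mp hxy.left
      simp [baseChange] at h
      linear_combination h
    subst hr hs
    have hneg' : s = -s - r := by exact_mod_cast hneg
    have heq' : s ^ 2 + r * s = r ^ 3 - r ^ 2 - 2 * r - 1 := by exact_mod_cast heq
    have hs2 : s = -r / 2 := by linarith
    rw [hs2] at heq'
    have hcubic : (r - 2) * (4 * r ^ 2 + 5 * r + 2) = 0 := by linear_combination (-4) * heq'
    have hquad : 0 < 4 * r ^ 2 + 5 * r + 2 := by nlinarith [sq_nonneg (8 * r + 5)]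
    have hr2 : r = 2 := by
      rcases mul_eq_zero.mp hcubic with h | h
      · linarith
      · exact absurd h hquad.ne'
    subst hr2
    have hs1 : s = -1 := by rw [hs2]; norm_num
    subst hs1
    exact ⟨by push_cast at hxy; exact_mod_cast hxy, by push_cast; norm_num⟩

/-! ## §5 (T-φ0): `φ(0) = T` for every datum of `X₀(49)` with odd Manin constant, granted `h12` -/

/-- **(T-φ0) GRANTED `h12`: for every modular parametrisation datum `Dt` of `X₀(49) = cm7` with ODD Manin constant
`c`, the cusp `0` maps to the `2`-torsion point `T = (2, −1)`: `Dt.cuspZeroPoint = (2, −1)`** — the VERBATIM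
consumer shape of planner g31 (cxli)(5) (`∃ h, … = .some 2 (−1) h`), derived from CLTZ Thm. 1.2 at `R = 1`
(`L(49a1,1)/Ω = #Ш/2`, `#Ш` odd) through `φ(0) = uniformize (c · {∞,0}_f)`, `{∞,0}_f = L(cm7,1)`, `Ω = Ω₀(Λ_E)`,
`uniformize_conj` and §4. [cite: CoatesLiTianZhai2015, Thm. 1.2 (p. 359, case r = 0)]
[cite: CremonaAlgorithms1997, §2.8 (2.8.3), §2.10 and Table 1 (49A1)] -/
theorem x049_cuspZeroPoint_eq_twoTorsion_of_thm12 (h12 : CoatesLiTianZhai2015.thm12_fullBSD_twist)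
    (Dt : ModularParametrizationData cm7 49) (hc : Odd Dt.c) :
    ∃ h, Dt.cuspZeroPoint = WeierstrassCurve.Affine.Point.some (x := 2) (y := -1) h := by
  obtain ⟨S, hS, hL⟩ := cm7_entireLFunction_one_eq_of_thm12 h12
  obtain ⟨hP0, h2, hconj⟩ := uniformize_half_realPeriod_spec Dt
  have hφ : Dt.cuspZeroPoint = Dt.uniformize ((cm7.realPeriodRat / 2 : ℝ) : ℂ) := by
    rw [ModularParametrizationData.cuspZeroPoint, modularSymbol_zero_eq_entireLFunction_one Dt, hL,
      ← uniformize_odd_mul_half_realPeriod Dt (hc.mul hS.natCast)]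
    congr 1
    push_cast
    ring
  rw [hφ]
  exact cm7_eq_two_neg_one_of_add_self_eq_zero_of_conj hP0 h2 hconj

/-- **(T-φ0) BY NAME, granted `h12`: the named input `x049_cuspZeroPoint_eq_twoTorsion` (seat ty's Literature def,
`X049CuspZeroTwoTorsion.lean`) HOLDS under CLTZ Thm. 1.2 at `R = 1`** — the `_holds` road for the consumers (c201 FILE 2
binder (d), c3x assembly): `h0 := x049_cuspZeroPoint_eq_twoTorsion_holds_of_thm12 h12`.
[cite: CoatesLiTianZhai2015, Thm. 1.2 (p. 359, case r = 0)] [cite: CremonaAlgorithms1997, Table 1 (49A1)] -/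
theorem x049_cuspZeroPoint_eq_twoTorsion_holds_of_thm12 (h12 : CoatesLiTianZhai2015.thm12_fullBSD_twist) :
    x049_cuspZeroPoint_eq_twoTorsion :=
  fun Dt hc ↦ x049_cuspZeroPoint_eq_twoTorsion_of_thm12 h12 Dt hc

/-- **(T-φ0) for `|c| = 1`** (the optimal / Manin-`±1` datum of `X₀(49)`), granted `h12`.
[cite: CoatesLiTianZhai2015, Thm. 1.2 (p. 359, case r = 0)] [cite: CremonaAlgorithms1997, Table 1 (49A1)] -/
theorem x049_cuspZeroPoint_eq_twoTorsion_of_abs_eq_one_of_thm12 (h12 : CoatesLiTianZhai2015.thm12_fullBSD_twist)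
    (Dt : ModularParametrizationData cm7 49) (hc : |Dt.c| = 1) :
    ∃ h, Dt.cuspZeroPoint = WeierstrassCurve.Affine.Point.some (x := 2) (y := -1) h := by
  refine x049_cuspZeroPoint_eq_twoTorsion_of_thm12 h12 Dt ?_
  rcases abs_eq (zero_le_one' ℤ) |>.mp hc with h | h <;> rw [h] <;> decide

/-- **For EVEN `c` the cusp `0` maps to `O`** (so `Odd Dt.c` is exactly the right hypothesis in (T-φ0)), granted
`h12`: `c · (#Ш/2) · Ω ∈ ℤΩ ⊆ Λ_E`. [cite: CoatesLiTianZhai2015, Thm. 1.2 (p. 359, case r = 0)] -/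
theorem x049_cuspZeroPoint_eq_zero_of_even_of_thm12 (h12 : CoatesLiTianZhai2015.thm12_fullBSD_twist)
    (Dt : ModularParametrizationData cm7 49) (hc : Even Dt.c) : Dt.cuspZeroPoint = 0 := by
  obtain ⟨S, -, hL⟩ := cm7_entireLFunction_one_eq_of_thm12 h12
  obtain ⟨k, hk⟩ := hc
  have hΩ : ((cm7.realPeriodRat : ℝ) : ℂ) ∈ Dt.L.lattice := by
    rw [realPeriodRat_cm7_eq_minRealPeriod Dt]
    exact Dt.isReal_neronLattice.minRealPeriod_mem_lattice
  rw [ModularParametrizationData.cuspZeroPoint, modularSymbol_zero_eq_entireLFunction_one Dt, hL,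
    Dt.uniformize_eq_zero_iff, hk,
    show (((k + k : ℤ)) : ℂ) * ((((S : ℝ) / 2 * cm7.realPeriodRat : ℝ)) : ℂ) = (k * S : ℤ) • ((cm7.realPeriodRat : ℝ) : ℂ) by
      rw [zsmul_eq_mul]; push_cast; ring]
  exact zsmul_mem hΩ _

end Summit.BirchSwinnertonDyer.BirchSwinnertonDyer.Theorems.GoldfeldGoodTwists

end
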